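import Summits.Parity.GeneralizedHardyLittlewood.Theorems.LiouvilleShiftedTablesSieveToMAvgI2Final

/-!
# Sieve glue for `SieveToMAvg`, part 8a: dispatching a Type-II box tuple

Support file for item stmt-Parity-14274 (route `LiouvilleShiftedTables`).  A box tuple `κ` of a
log-free Heath-Brown piece (part 3) with a set of slots `S` whose boxes multiply into the Type-II
window is the bilinear piece `α ⋆ β`, `α = ∏_{i∈S} bFactor`, `β = ∏_{i∉S} bFactor`; parts 6a–6d
bound its correlation functional.  Here we supply the bookkeeping: supports
(`a ∈ (A, 2^{#S} A]`, `A = ∏_{i∈S} P_i`), the `ℓ²` norms through divisor power sums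
(`|α| ≤ τ^{#S}`), and the sliver term through the absolute product `absProd κ = ∏_i |bFactor_i|`
(whose sum over all tuples is `≤ τ^{2j}` pointwise, for the global sliver estimate of part 9).
-/

namespace Summit.Parity.GeneralizedHardyLittlewood.Theorems.SieveToMAvg

open Finset Real
open scoped ArithmeticFunction.zeta ArithmeticFunction.sigma
open Literature.NumberTheory.Sieve (abs_prod_apply_le_sigma_zero_pow)
open Literature.NumberTheory.Sieve.BFI

/-- Divisor power sums `Dτ(r, y) = ∑_{n ≤ y} τ(n)^r`. [folklore] -/
noncomputable def Dtau (r : ℕ) (y : ℝ) : ℝ := ∑ n ∈ Icc 1 ⌊y⌋₊, (σ 0 n : ℝ) ^ r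

/-- `Dτ ≥ 0`. [folklore] -/
theorem Dtau_nonneg (r : ℕ) (y : ℝ) : 0 ≤ Dtau r y := Finset.sum_nonneg fun _ _ => by positivity

/-- `Dτ` is monotone in `y`. [folklore] -/
theorem Dtau_mono (r : ℕ) {y y' : ℝ} (h : y ≤ y') : Dtau r y ≤ Dtau r y' :=
  Finset.sum_le_sum_of_subset_of_nonneg (Finset.Icc_subset_Icc_right (Nat.floor_le_floor h)) fun _ _ _ => by positivity

section DispatchII

variable {x : ℝ} {U j t : ℕ}

/-- The absolute product of a tuple: `absProd κ = ∏_i |bFactor i (κ i)|` (Dirichlet product of the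
absolute values). [folklore] -/
noncomputable def absProd (x : ℝ) (U j t : ℕ) (κ : Fin (2 * j) → ℕ) : ArithmeticFunction ℝ :=
  ∏ i : Fin (2 * j), absAF (bFactor x U j t i (κ i))

/-- `absProd κ ≥ 0` pointwise. [folklore] -/
theorem absProd_nonneg (κ : Fin (2 * j) → ℕ) (n : ℕ) : 0 ≤ absProd x U j t κ n :=
  prod_apply_nonneg _ (fun _ _ _ => abs_nonneg _) n

/-- **Summing the absolute products over all tuples**: `∑_κ absProd κ (n) ≤ τ(n)^{2j}` (`x > 0`). [folklore] -/
theorem sum_absProd_le (hx : 0 < x) (K n : ℕ) :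
    ∑ κ ∈ tuples j K, absProd x U j t κ n ≤ (σ 0 n : ℝ) ^ (2 * j) := by
  unfold tuples absProd
  rw [← Literature.NumberTheory.Sieve.HeathBrown.finset_sum_apply]
  have heq : (∑ κ ∈ Fintype.piFinset (fun _ : Fin (2 * j) => Finset.range K),
      ∏ i : Fin (2 * j), absAF (bFactor x U j t i (κ i))) =
      ∏ i : Fin (2 * j), ∑ k ∈ Finset.range K, absAF (bFactor x U j t i k) :=
    (Finset.prod_univ_sum (fun _ : Fin (2 * j) => Finset.range K)
      (fun (i : Fin (2 * j)) (k : ℕ) => absAF (bFactor x U j t i k))).symm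
  rw [heq]
  have hle : (∏ i : Fin (2 * j), ∑ k ∈ Finset.range K, absAF (bFactor x U j t i k)) n ≤
      (∏ _i : Fin (2 * j), (ζ : ArithmeticFunction ℝ)) n := by
    refine prod_apply_le_prod_apply (Finset.univ : Finset (Fin (2 * j))) (fun i _ d => ?_) (fun i _ d => ?_) n
    · rw [Literature.NumberTheory.Sieve.HeathBrown.finset_sum_apply]
      exact Finset.sum_nonneg fun _ _ => abs_nonneg _
    · rw [Literature.NumberTheory.Sieve.HeathBrown.finset_sum_apply]
      simp only [absAF_apply]
      exact sum_abs_bFactor_le hx i K d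
  exact hle.trans (prod_zeta_apply_le _ _)

/-- A binary monotonicity for Dirichlet products of nonnegative functions. [folklore] -/
theorem mul_apply_le_mul_apply {f f' g g' : ArithmeticFunction ℝ} (hf : ∀ d, 0 ≤ f d) (hg : ∀ d, 0 ≤ g d)
    (hff' : ∀ d, f d ≤ f' d) (hgg' : ∀ d, g d ≤ g' d) (n : ℕ) : (f * g) n ≤ (f' * g') n := by
  rw [ArithmeticFunction.mul_apply, ArithmeticFunction.mul_apply]
  exact Finset.sum_le_sum fun p _ => mul_le_mul (hff' _) (hgg' _) (hg _) ((hf _).trans (hff' _))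

/-- The sliver majorant: `(|α| ⋆ |β|)(n) ≤ absProd κ (n)` for the grouping `α = ∏_{i∈S}`, `β = ∏_{i∉S}`. [folklore] -/
theorem absAF_mul_absAF_le_absProd (κ : Fin (2 * j) → ℕ) (S : Finset (Fin (2 * j))) (n : ℕ) :
    (absAF (∏ i ∈ S, bFactor x U j t i (κ i)) * absAF (∏ i ∈ Sᶜ, bFactor x U j t i (κ i))) n ≤
      absProd x U j t κ n := by
  have hprod : absProd x U j t κ =
      (∏ i ∈ S, absAF (bFactor x U j t i (κ i))) * ∏ i ∈ Sᶜ, absAF (bFactor x U j t i (κ i)) := by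
    unfold absProd
    exact (Finset.prod_mul_prod_compl S _).symm
  rw [hprod]
  refine mul_apply_le_mul_apply (fun d => abs_nonneg _) (fun d => abs_nonneg _) (fun d => ?_) (fun d => ?_) n
  · rw [absAF_apply]; exact abs_prod_apply_le S _ d
  · rw [absAF_apply]; exact abs_prod_apply_le Sᶜ _ d

/-- `prodB κ = (∏_{i∈S} bFactor) ⋆ (∏_{i∉S} bFactor)`. [folklore] -/
theorem prodB_eq_mul_compl (κ : Fin (2 * j) → ℕ) (S : Finset (Fin (2 * j))) :
    prodB x U j t κ = (∏ i ∈ S, bFactor x U j t i (κ i)) * ∏ i ∈ Sᶜ, bFactor x U j t i (κ i) := by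
  unfold prodB
  exact (Finset.prod_mul_prod_compl S _).symm

/-- The `ℓ²` norm of a sub-product through a divisor power sum: for `T ⊆ Fin 2j` nonempty with
`2^{#T} ∏_{i∈T} P_i ≤ Y`, `∑_{a ≤ 2x} (∏_{i∈T} bFactor)(a)² ≤ Dτ(4j, Y)` (`x > 0`). [folklore] -/
theorem sum_sq_subprod_le (hx : 0 < x) (κ : Fin (2 * j) → ℕ) {T : Finset (Fin (2 * j))} (hT : T.Nonempty)
    {Y : ℝ} (hY : 2 ^ T.card * ∏ i ∈ T, P x (κ i) ≤ Y) :
    ∑ a ∈ Ioc 0 ⌊2 * x⌋₊, ((∏ i ∈ T, bFactor x U j t i (κ i)) a) ^ 2 ≤ Dtau (4 * j) Y := by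
  classical
  unfold Dtau
  set α := ∏ i ∈ T, bFactor x U j t i (κ i) with hα
  have hcard : T.card ≤ 2 * j := by
    have := Finset.card_le_univ T; rwa [Fintype.card_fin] at this
  -- pointwise: `α(a)² ≤ τ(a)^{4j}` for `a ≥ 1`, and `α` is supported on `a ≤ Y`
  have hpt : ∀ a : ℕ, 1 ≤ a → (α a) ^ 2 ≤ (σ 0 a : ℝ) ^ (4 * j) := by
    intro a ha
    have h1 : |α a| ≤ (σ 0 a : ℝ) ^ T.card := abs_subprod_le κ T a
    have hτ : (1 : ℝ) ≤ (σ 0 a : ℝ) := by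
      exact_mod_cast Literature.NumberTheory.Sieve.one_le_sigma_zero (by omega : a ≠ 0)
    calc (α a) ^ 2 = |α a| ^ 2 := (sq_abs _).symm
      _ ≤ ((σ 0 a : ℝ) ^ T.card) ^ 2 := pow_le_pow_left₀ (abs_nonneg _) h1 2
      _ = (σ 0 a : ℝ) ^ (2 * T.card) := by rw [← pow_mul, mul_comm]
      _ ≤ (σ 0 a : ℝ) ^ (4 * j) := pow_le_pow_right₀ hτ (by omega)
  have hsupp : ∀ a : ℕ, α a ≠ 0 → a ∈ Icc 1 ⌊Y⌋₊ := by
    intro a ha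
    obtain ⟨h1, h2⟩ := subprod_ne_zero hx κ hT ha
    have hpos : 0 < ∏ i ∈ T, P x (κ i) := Finset.prod_pos fun i _ => P_pos hx (κ i)
    rw [Finset.mem_Icc]
    refine ⟨?_, Nat.le_floor (h2.trans hY)⟩
    have : (0 : ℝ) < a := hpos.trans h1
    exact_mod_cast this
  calc ∑ a ∈ Ioc 0 ⌊2 * x⌋₊, (α a) ^ 2
      = ∑ a ∈ (Ioc 0 ⌊2 * x⌋₊).filter (fun a => α a ≠ 0), (α a) ^ 2 := by
        rw [Finset.sum_filter]
        refine Finset.sum_congr rfl fun a _ => ?_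
        split_ifs with h0
        · rfl
        · push Not at h0; rw [h0]; ring
    _ ≤ ∑ a ∈ Icc 1 ⌊Y⌋₊, (α a) ^ 2 :=
        Finset.sum_le_sum_of_subset_of_nonneg (fun a ha => hsupp a (Finset.mem_filter.1 ha).2) fun _ _ _ => sq_nonneg _
    _ ≤ ∑ a ∈ Icc 1 ⌊Y⌋₊, (σ 0 a : ℝ) ^ (4 * j) :=
        Finset.sum_le_sum fun a ha => hpt a (Finset.mem_Icc.1 ha).1

variable {h : ℕ} {X Δ₁ δ C : ℝ}

/-- **Dispatching a Type-II tuple.**  Under `HypII X (−h) δ C`: if the boxes of the slots in `S`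
(`S, Sᶜ ≠ ∅`) satisfy `(1+Δ₁)X^δ ≤ A = ∏_{i∈S} P_i`, `2^{#S} A ≤ X^{1/3+δ}`, `2^{#S} A ≤ 2x`, then
`TT(prodB κ) ≤ √K₁ √(Dτ(4j, 2^{#S}A)) √(Dτ(4j, 2^{#Sᶜ}B)) (X²/(log X)^C)^{1/4} H_Q^{3/4} + sliver_κ`
(`B = ∏_{i∉S} P_i`; `2 ≤ X^δ`, `0 < Δ₁ ≤ 1/2`, `2x < (1+Δ₁)^{K₁}`, `Q ≤ ⌊X^{δ/2}⌋`, `0 < x`, `2x ≤ X`). [folklore] -/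
theorem TT_prodB_le_typeII (hyp : HypII X (-(h : ℤ)) δ C) (hX : 1 ≤ X) (hx : 0 < x) (hxX : 2 * x ≤ X)
    (hΔ₁ : 0 < Δ₁) (hΔ₁' : Δ₁ ≤ 1 / 2) {Q : ℕ} (hQ : Q ≤ ⌊X ^ (δ / 2)⌋₊) (h2 : 2 ≤ X ^ δ)
    {K₁ : ℕ} (hK₁ : 2 * x < (1 + Δ₁) ^ K₁)
    (κ : Fin (2 * j) → ℕ) {S : Finset (Fin (2 * j))} (hS : S.Nonempty) (hSc : Sᶜ.Nonempty)
    (hA₁ : (1 + Δ₁) * X ^ δ ≤ ∏ i ∈ S, P x (κ i)) (hA₂ : 2 ^ S.card * ∏ i ∈ S, P x (κ i) ≤ X ^ (1 / 3 + δ))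
    (hA₂x : 2 ^ S.card * ∏ i ∈ S, P x (κ i) ≤ 2 * x) :
    TT (lamW h) h Q x (fun n => prodB x U j t κ n) ≤
      Real.sqrt K₁ * Real.sqrt (Dtau (4 * j) (2 ^ S.card * ∏ i ∈ S, P x (κ i))) *
        Real.sqrt (Dtau (4 * j) (2 ^ Sᶜ.card * ∏ i ∈ Sᶜ, P x (κ i))) *
          ((X ^ 2 / Real.log X ^ C) ^ ((1 : ℝ) / 4) * (∑ q ∈ Icc 1 Q, (q : ℝ)⁻¹) ^ ((3 : ℝ) / 4)) +
      ∑ q ∈ moduli Q h, ∑ n ∈ (dyadClass h q x).filter (fun n => Sliver x Δ₁ n), absProd x U j t κ n := by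
  set α := ∏ i ∈ S, bFactor x U j t i (κ i) with hα
  set β := ∏ i ∈ Sᶜ, bFactor x U j t i (κ i) with hβ
  set A := ∏ i ∈ S, P x (κ i) with hA
  set A₂ := 2 ^ S.card * A with hA₂def
  have hApos : 0 < A := Finset.prod_pos fun i _ => P_pos hx (κ i)
  have hA₂pos : 0 < A₂ := by positivity
  have hαsupp : ∀ a : ℕ, α a ≠ 0 → A ≤ (a : ℝ) ∧ (a : ℝ) ≤ A₂ := by
    intro a ha
    obtain ⟨h1, h2⟩ := subprod_ne_zero hx κ hS ha
    exact ⟨h1.le, h2⟩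
  have hK₁' : A₂ < (1 + Δ₁) ^ K₁ := lt_of_le_of_lt hA₂x hK₁
  -- part 6a: reduce to main pieces + slivers
  have hred := TT_mul_le (h := h) (β := β) hx.le hA₂pos hΔ₁ hK₁' (fun a ha => (hαsupp a ha).2) Q
  have hprod : (fun n => prodB x U j t κ n) = fun n => (α * β) n := by
    ext n; rw [prodB_eq_mul_compl κ S]
  rw [hprod]
  refine hred.trans (add_le_add ?_ ?_)
  · -- part 6d: the main pieces
    have hmain := sum_sum_abs_mainPiece_le (α := α) (β := β) hyp hX hx hxX hΔ₁ hΔ₁' hQ hαsupp hA₁ hA₂ hA₂x h2 hA₂pos hK₁'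
    refine hmain.trans ?_
    have hW0 : 0 ≤ (X ^ 2 / Real.log X ^ C) ^ ((1 : ℝ) / 4) * (∑ q ∈ Icc 1 Q, (q : ℝ)⁻¹) ^ ((3 : ℝ) / 4) := by
      have h1 : 0 ≤ X ^ 2 / Real.log X ^ C :=
        div_nonneg (pow_nonneg (by linarith) 2) (Real.rpow_nonneg (Real.log_nonneg hX) C)
      have h2' : 0 ≤ ∑ q ∈ Icc 1 Q, (q : ℝ)⁻¹ := Finset.sum_nonneg fun q _ => by positivity
      positivity
    have hαn : Real.sqrt (∑ a ∈ Ioc 0 ⌊2 * x⌋₊, (α a) ^ 2) ≤ Real.sqrt (Dtau (4 * j) A₂) :=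
      Real.sqrt_le_sqrt (sum_sq_subprod_le hx κ hS le_rfl)
    have hβn : Real.sqrt (∑ b ∈ Ioc 0 ⌊2 * x⌋₊, (β b) ^ 2) ≤
        Real.sqrt (Dtau (4 * j) (2 ^ Sᶜ.card * ∏ i ∈ Sᶜ, P x (κ i))) :=
      Real.sqrt_le_sqrt (sum_sq_subprod_le hx κ hSc le_rfl)
    gcongr
  · exact Finset.sum_le_sum fun q _ => Finset.sum_le_sum fun n _ => absAF_mul_absAF_le_absProd κ S n

end DispatchII

end Summit.Parity.GeneralizedHardyLittlewood.Theorems.SieveToMAvg
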